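import Summits.BirchSwinnertonDyer.BirchSwinnertonDyer.Theorems.ResidualThetaTransportAtTwoThetaLayerLambdaCongruenceAtTwoCurveMuIffFlat
import Summits.BirchSwinnertonDyer.BirchSwinnertonDyer.Theorems.ResidualThetaTransportAtTwoSignedMuVanishingAtTwoPlusAnalyticChild
import Literature.NumberTheory.EllipticCurves.IsogenyFrobeniusTraceHoldsProofs
import Literature.NumberTheory.EllipticCurves.HeckeEigenvalueSupNormStrictProofs
import HarnessLib

/-!
# Crux Kan⁺ `ThetaLayerLambdaCongruenceAtTwo` (stmt-BirchSwinnertonDyer-20688, route ResidualThetaTransportAtTwo), line `birth`: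
# (NR-g) WITHOUT DELIGNE, and the crux BY NAME from SIX print facts + the route item 21437

Width seat bsd-wall-rtt-p3-w3 g5 (`--supports stmt-BirchSwinnertonDyer-20688`; closes nothing; THEOREMS ONLY — no `def`,
no `sorry`; every remaining hypothesis is a Literature named fact BY NAME or a route decl BY NAME; BSD is not proved by this).

WHY THIS FILE. In the landed chain for Kan⁺ (lead g7/g8, `…StarCruxGlue`, `…CurveMuIffFlat`, `…OfSignedMuAnalytic`) Deligne's theorem
(`Deligne1974_heckeT_eigenvalue_norm_le`, Weil I Thm. 8.2 — print, unproved in the tree) enters at ONE place: the registered v8 stub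
(NR-g) `stub_partnerEulerFactorNonRoot` «for every newform `g` on `Γ₀(M)`, prime `ℓ`, root of unity `ζ ∈ ℚ̄₂`: `P_{g,ℓ}(ζ/ℓ) ≠ 0`»
(`…EulerFactorNonRoot.eval_partnerEulerPolynomial_ne_zero_of_deligne`). At a good prime this says that no root of `X² − a_ℓ(g)X + ℓ`
is a root of unity; since `a_ℓ(g)` is REAL (self-adjointness of `T_ℓ`, tree) a unimodular root is `±1` and `a_ℓ(g) = ±(ℓ + 1)` —
the Eisenstein eigenvalue, which the trivial (Hecke) bound `|a_ℓ| ≤ ℓ + 1` does not exclude but the STRICT trivial bound does. The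
strict bound is now a tree theorem (`Literature/…/HeckeEigenvalueSupNormStrictProofs`: the sup of `y^k|g|²` is attained; at a maximum
point equality would propagate to `ℓⁿτ₀`, contradicting decay at `i∞`). Hence:
* `eval_partnerEulerPolynomial_ne_zero` — (NR-g) at good primes, UNCONDITIONAL; `partnerEulerFactorNonRoot` — the v8 stub text
  VERBATIM, UNCONDITIONAL (level primes by the tree's Atkin–Lehner bound `norm_cuspCoeff_le_one_of_dvd_level`).
* `thetaLayerLambdaCongruenceAtTwo_of_sixFacts_flatMuZeroAtTwo` — the crux BY NAME from SIX print facts {Eichler–Shimura depleted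
  optimal quotient, Mazur–Kenku, Hecke self-duality of `J₀[2]`, Buzzard mod-2 multiplicity one, Serre 1972 Prop. 12} ∪ {—} and
  Kμ⁺'s FLAT (Faltings supplied by the tree theorem `isIsogenous_iff_frobeniusTrace_eq_holds`, Deligne by this file);
* `thetaLayerLambdaCongruenceAtTwo_of_sixFacts_abbesUllmo_signedMuAnalytic` / `kanP6_of_pub_of_signedMuAnalyticAtTwoPlus` —
  **Kan⁺ ⟸ {ES, MK, SD, Bz, Se, AU} + item 21437**: the pen's twin KanP needs SIX print binders (was eight in p612933).

References: [Deligne1974] Thm. 8.2 (no longer an input); [DiamondShurman2005] Prop. 5.2.1, Thm. 5.5.3; [AtkinLehner1970] Thm. 3;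
[AbbesUllmo1996] Thm. A; [Pollack2003] Conj. 6.3; [GreenbergVatsal2000] §1 (10).
-/

noncomputable section

-- justification: the `Summit.BirchSwinnertonDyer.BirchSwinnertonDyer.…` path repeats a component (route-file convention)
set_option linter.dupNamespace false

open scoped Classical MatrixGroups

open Polynomial CongruenceSubgroup Literature.NumberTheory.EllipticCurves Literature.NumberTheory.EllipticCurves.ModularForms
open Summit.BirchSwinnertonDyer.BirchSwinnertonDyer.Theses.ResidualThetaTransportAtTwo

namespace Summit.BirchSwinnertonDyer.BirchSwinnertonDyer.Theorems.ThetaLayerLambdaCongruenceAtTwo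

/-! ## §1. (NR-g) at a good prime WITHOUT Deligne -/

section Good

variable {M : ℕ} [NeZero M] {g : CuspForm (CongruenceSubgroup.Gamma0 M) 2} (ι : coeffField g →+* PadicAlgCl 2)

/-- **(NR-g) at a good prime `ℓ ∤ M`, unconditionally.** For a newform `g` on `Γ₀(M)` and a root of unity `ζ ∈ ℚ̄₂`:
`P_{g,ℓ}(ζ/ℓ) = 1 − ι a_ℓ(g) ζ/ℓ + ζ²/ℓ ≠ 0`. Otherwise `X² − a_ℓ X + ℓ ∈ K_g[X]` has the root `ζ` along `ι`, hence
(`exists_complex_rootOfUnity_root_of_padic`) a complex root of unity `z`; `a_ℓ(g)` is an eigenvalue of `T_ℓ` on `S₂(Γ₀(M))`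
(`IsNewform0.heckeT_eq_coeff_smul`), and a weight-`2` Hecke eigenvalue at `ℓ ∤ M` admits no root-of-unity root of `X² − a_ℓ X + ℓ`
(`false_of_rootOfUnity_root_weight_two`: real eigenvalue + STRICT trivial bound `|a_ℓ| < ℓ + 1`).
[cite: DiamondShurman2005, Prop. 5.2.1 and Thm. 5.5.3] -/
theorem eval_partnerEulerPolynomial_ne_zero (hg : IsNewform0 g) {ℓ : ℕ} (hℓ : ℓ.Prime) (hℓM : ¬ ℓ ∣ M)
    (ζ : PadicAlgCl 2) (hζ : ∃ m : ℕ, 0 < m ∧ ζ ^ m = 1) :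
    Polynomial.eval (ζ * ((ℓ : PadicAlgCl 2))⁻¹) (1 - Polynomial.C (embCoeff g ι ℓ) * Polynomial.X +
      (if ℓ ∣ M then 0 else Polynomial.C (ℓ : PadicAlgCl 2)) * Polynomial.X ^ 2 : Polynomial (PadicAlgCl 2)) ≠ 0 := by
  obtain ⟨m, hm, hζm⟩ := hζ
  haveI : NeZero ℓ := ⟨hℓ.ne_zero⟩
  rw [if_neg hℓM]
  intro heval
  have hℓ0 : (ℓ : PadicAlgCl 2) ≠ 0 := by exact_mod_cast hℓ.ne_zero
  -- `ζ` is a root of `X² − a_ℓ X + ℓ` along `ι`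
  have hQ : ((X ^ 2 - C (⟨cuspCoeff g ℓ, coeff_mem_coeffField g ℓ⟩ : coeffField g) * X + C (ℓ : coeffField g) :
      (coeffField g)[X]).map ι).eval ζ = 0 := by
    have e : ((X ^ 2 - C (⟨cuspCoeff g ℓ, coeff_mem_coeffField g ℓ⟩ : coeffField g) * X + C (ℓ : coeffField g) :
        (coeffField g)[X]).map ι).eval ζ =
        (ℓ : PadicAlgCl 2) * Polynomial.eval (ζ * ((ℓ : PadicAlgCl 2))⁻¹)
          (1 - Polynomial.C (embCoeff g ι ℓ) * Polynomial.X + Polynomial.C (ℓ : PadicAlgCl 2) * Polynomial.X ^ 2) := by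
      rw [embCoeff_def]
      simp only [Polynomial.map_add, Polynomial.map_sub, Polynomial.map_pow, Polynomial.map_mul, map_X, map_C,
        map_natCast, Polynomial.map_natCast, eval_add, eval_sub, eval_pow, eval_mul, eval_X, eval_C, eval_natCast,
        eval_one]
      field_simp
      ring
    rw [e, heval, mul_zero]
  obtain ⟨z, hzm, hz⟩ := exists_complex_rootOfUnity_root_of_padic ι _ hζm hQ
  -- `z² − a_ℓ(g) z + ℓ = 0` in `ℂ`
  have hroot : z ^ 2 - cuspCoeff g ℓ * z + (ℓ : ℂ) = 0 := by
    have hz' := hz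
    simp only [map_add, map_sub, map_mul, map_pow, aeval_X, aeval_C, map_natCast] at hz'
    rw [← hz']
    rfl
  -- `a_ℓ(g)` is an eigenvalue of `T_ℓ` on `S₂(Γ₀(M))`
  have hμ : Module.End.HasEigenvalue (heckeT (Gamma0 M) 2 ℓ) (cuspCoeff g ℓ) :=
    Module.End.hasEigenvalue_of_hasEigenvector
      ⟨Module.End.mem_eigenspace_iff.mpr (hg.heckeT_eq_coeff_smul hℓ), IsNormalized.ne_zero_gamma0 hg.2.2⟩
  exact false_of_rootOfUnity_root_weight_two hℓ hℓM hμ hm hzm hroot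

end Good

/-! ## §2. The v8 stub (NR-g) VERBATIM, unconditional -/

/-- **(NR-g) — the registered stub `stub_partnerEulerFactorNonRoot` of skeleton v8, VERBATIM, now UNCONDITIONAL**:
for every newform `g` on `Γ₀(M)`, embedding `ι : K_g → ℚ̄₂`, prime `ℓ` and root of unity `ζ ∈ ℚ̄₂`, `P_{g,ℓ}(ζ/ℓ) ≠ 0`
(good primes: §1; level primes: the tree's Atkin–Lehner bound `norm_cuspCoeff_le_one_of_dvd_level` with
`eval_partnerEulerPolynomial_ne_zero_of_levelCoeffBound`). [cite: AtkinLehner1970, Thm. 3] [cite: DiamondShurman2005, Prop. 5.2.1] -/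
theorem partnerEulerFactorNonRoot :
    ∀ (M : ℕ) [NeZero M] (g : CuspForm (CongruenceSubgroup.Gamma0 M) 2) (ι : Literature.NumberTheory.EllipticCurves.ModularForms.coeffField g →+* PadicAlgCl 2), Literature.NumberTheory.EllipticCurves.ModularForms.IsNewform0 g → ∀ ℓ : ℕ, ℓ.Prime → ∀ ζ : PadicAlgCl 2, (∃ m : ℕ, 0 < m ∧ ζ ^ m = 1) → Polynomial.eval (ζ * ((ℓ : PadicAlgCl 2))⁻¹) (1 - Polynomial.C (embCoeff g ι ℓ) * Polynomial.X + (if ℓ ∣ M then 0 else Polynomial.C (ℓ : PadicAlgCl 2)) * Polynomial.X ^ 2 : Polynomial (PadicAlgCl 2)) ≠ 0 := by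
  intro M _ g ι hg ℓ hℓ ζ hζ
  by_cases hℓM : ℓ ∣ M
  · exact eval_partnerEulerPolynomial_ne_zero_of_levelCoeffBound ι hℓ hℓM
      (norm_cuspCoeff_le_one_of_dvd_level hg hℓ hℓM) ζ hζ
  · exact eval_partnerEulerPolynomial_ne_zero ι hg hℓ hℓM ζ hζ

/-! ## §3. The crux BY NAME from SIX print facts -/

/-- **THE CRUX `ThetaLayerLambdaCongruenceAtTwo` BY NAME from the plus-line facts MINUS Faltings and Deligne + Kμ⁺'s FLAT**:
(C3⁺) from `plusLineCharTwo_of_facts` with the Faltings binder supplied by the tree theorem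
`WeierstrassCurve.isIsogenous_iff_frobeniusTrace_eq_holds`; (μ-W₁) from FLAT (`stub_curveDepletedSymbolMaxAtTwoPowerCusp_of_flatMuZeroAtTwo`);
(NR-g) from §2. Five print binders + the research statement FLAT. BSD is not proved by this.
[cite: GreenbergVatsal2000, §1 (10) and Prop. (2.4) (shape)] [cite: Pollack2003, Conj. 6.3] -/
theorem thetaLayerLambdaCongruenceAtTwo_of_sixFacts_flatMuZeroAtTwo
    (hES : eichlerShimura_depletedOptimalQuotient_periodLattice_of_dvd)
    (hMK : mazurKenku_exists_cyclic_isogeny)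
    (hSD : heckeSelfDual_torsionBy_J0) (hBz : buzzard2000_multiplicityOne_gamma0)
    (hSe : serre1972_supersingular_decompositionSubgroup_image)
    (hflat : ∀ (W : WeierstrassCurve ℚ) [W.IsElliptic] [W.IsGloballyMinimal], ¬ W.HasCM → W.analyticRank = 0 → Literature.NumberTheory.EllipticCurves.Rank1Residual.GoodSS W 2 → W.frobeniusTrace 2 = 0 → W.Δ < 0 → ∀ [NeZero (W.conductorNorm ℤ)] (f : CuspForm (CongruenceSubgroup.Gamma0 (W.conductorNorm ℤ)) 2), Literature.NumberTheory.EllipticCurves.ModularForms.IsNewformOf W f → ∀ (Lplus Lminus : Literature.NumberTheory.EllipticCurves.IwasawaAlgebra 2), Summit.BirchSwinnertonDyer.Rank1Residual.Supersingular.IsPollackPair f 2 Lplus Lminus → ¬ PowerSeries.C (2 : ℤ_[2]) ∣ Lminus) :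
    ThetaLayerLambdaCongruenceAtTwo :=
  thetaLayerLambdaCongruenceAtTwo_of_plusLineLevel_curveMax_nonRoot
    (plusLineAtTwoLevel_of_charTwoLevel
      (plusLineCharTwo_of_facts hES WeierstrassCurve.isIsogenous_iff_frobeniusTrace_eq_holds hMK hSD hBz hSe))
    (stub_curveDepletedSymbolMaxAtTwoPowerCusp_of_flatMuZeroAtTwo hflat) partnerEulerFactorNonRoot

/-- **Kan⁺ `ThetaLayerLambdaCongruenceAtTwo` BY NAME from SIX Literature named facts + the route item 21437
`SignedMuAnalyticAtTwoPlus`** — Eichler–Shimura (depleted optimal quotient), Mazur–Kenku, Hecke self-duality of `J₀[2]`,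
Buzzard's mod-`2` multiplicity one, Serre 1972 Prop. 12, Abbes–Ullmo Thm. A; Faltings and Deligne are no longer inputs
(tree theorems). 21437 ⟹ FLAT granted Abbes–Ullmo (`signedMuAnalyticAtTwoPlus_iff_flatMuZero_of_abbesUllmo`, rtt-p4).
Conditional on six print facts and on an OPEN item; BSD is not proved by this.
[cite: AbbesUllmo1996, Thm. A] [cite: Pollack2003, Conj. 6.3 and Prop. 6.18 (shape)] -/
theorem thetaLayerLambdaCongruenceAtTwo_of_sixFacts_abbesUllmo_signedMuAnalytic
    (hES : eichlerShimura_depletedOptimalQuotient_periodLattice_of_dvd)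
    (hMK : mazurKenku_exists_cyclic_isogeny)
    (hSD : heckeSelfDual_torsionBy_J0) (hBz : buzzard2000_multiplicityOne_gamma0)
    (hSe : serre1972_supersingular_decompositionSubgroup_image)
    (hAU : abbesUllmo_not_dvd_maninConstant_of_not_dvd_level)
    (hμ : SignedMuAnalyticAtTwoPlus) :
    ThetaLayerLambdaCongruenceAtTwo :=
  thetaLayerLambdaCongruenceAtTwo_of_sixFacts_flatMuZeroAtTwo hES hMK hSD hBz hSe
    ((Summit.BirchSwinnertonDyer.BirchSwinnertonDyer.Theorems.signedMuAnalyticAtTwoPlus_iff_flatMuZero_of_abbesUllmo hAU).mp hμ)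

/-- **Abbes–Ullmo-free form**: Kan⁺ BY NAME from FIVE Literature named facts, the period-unit statement PER at `2` (inline
hypothesis) and the route item 21437. BSD is not proved by this. [cite: Pollack2003, Prop. 6.18 (shape)] -/
theorem thetaLayerLambdaCongruenceAtTwo_of_fiveFacts_periodUnit_signedMuAnalytic
    (hES : eichlerShimura_depletedOptimalQuotient_periodLattice_of_dvd)
    (hMK : mazurKenku_exists_cyclic_isogeny)
    (hSD : heckeSelfDual_torsionBy_J0) (hBz : buzzard2000_multiplicityOne_gamma0)
    (hSe : serre1972_supersingular_decompositionSubgroup_image)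
    (hper : ∀ (W : WeierstrassCurve ℚ) [W.IsElliptic] [W.IsGloballyMinimal],
      Literature.NumberTheory.EllipticCurves.Rank1Residual.GoodSS W 2 →
      ∀ [NeZero (W.conductorNorm ℤ)] (f : CuspForm (Gamma0 (W.conductorNorm ℤ)) 2), IsNewformOf W f →
      ∃ u : ℚ, ‖(u : ℚ_[2])‖ = 1 ∧ W.realPeriodRat = u * plusPeriod f)
    (hμ : SignedMuAnalyticAtTwoPlus) :
    ThetaLayerLambdaCongruenceAtTwo :=
  thetaLayerLambdaCongruenceAtTwo_of_sixFacts_flatMuZeroAtTwo hES hMK hSD hBz hSe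
    (Summit.BirchSwinnertonDyer.BirchSwinnertonDyer.Theorems.flatMuZero_of_signedMuAnalyticAtTwoPlus_of_periodUnit hμ hper)

/-- **Curried form for a route binder list** (the pen's twin «KanP» with SIX print binders): Eichler–Shimura, Mazur–Kenku,
Hecke self-duality, Buzzard, Serre, Abbes–Ullmo, then the item 21437, then the crux — all BY NAME. -/
theorem kanP6_of_pub_of_signedMuAnalyticAtTwoPlus :
    eichlerShimura_depletedOptimalQuotient_periodLattice_of_dvd → mazurKenku_exists_cyclic_isogeny →
    heckeSelfDual_torsionBy_J0 → buzzard2000_multiplicityOne_gamma0 →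
    serre1972_supersingular_decompositionSubgroup_image →
    abbesUllmo_not_dvd_maninConstant_of_not_dvd_level → SignedMuAnalyticAtTwoPlus → ThetaLayerLambdaCongruenceAtTwo :=
  thetaLayerLambdaCongruenceAtTwo_of_sixFacts_abbesUllmo_signedMuAnalytic

end Summit.BirchSwinnertonDyer.BirchSwinnertonDyer.Theorems.ThetaLayerLambdaCongruenceAtTwo

end
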